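import Literature.Probability.LatticeModels.GaussianPairingBound
import Literature.Probability.LatticeModels.LebowitzPairTruncationIsing
import Literature.Probability.LatticeModels.MeanFieldBoundGHS
import Literature.Probability.LatticeModels.SharpnessDecayProofs
import Literature.Probability.LatticeModels.SharpnessLROProofs
import HarnessLib

/-!
# Exponential clustering of even spin observables of the high-temperature Ising model
(Glimm–Jaffe 1987, §17.2: Thm. 17.2.1 and Cor. 17.2.2, on the lattice `ℤ^d`)

Topic `Probability/LatticeModels`. Theorem-only file (no definitions, no named facts).

Glimm–Jaffe, *Quantum Physics*, §17.2 («the even subspace has no spectrum in `(0, 2m)`»):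
Thm. 17.2.1 is the pair-truncation tree bound of Cor. 4.3.3 for the zero-field model — for `|A|`,
`|B|` even,
`⟨σ_Aσ_B⟩ - ⟨σ_A⟩⟨σ_B⟩ ≤ ∑_{A₁ ⊂ A odd, B₁ ⊂ B odd} ⟨σ_{A₁}σ_{B₁}⟩⟨σ_{A∖A₁}σ_{B∖B₁}⟩` —
and Cor. 17.2.2 deduces from it that truncated correlations of EVEN observables decay at TWICE the
rate of the two-point function («no even bound states below the two-particle threshold»): each
summand is a product of two odd–odd correlations between `A` and `B`, each of which decays like the
two-point function. On the lattice, for the nearest-neighbour Ising model on `ℤ^d` at `0 ≤ β <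
β_c(d)`, the odd–odd step is supplied here by Newman's Gaussian inequality (the lower half of
Aizenman's inequality — the tree's PROVED `aizenman_nPoint_le_pairingSum_finite_holds`,
`GaussianPairingBound`): in every pairing of the points of `A₁ ∪ B₁` (`|A₁|`, `|B₁|` odd, disjoint)
some pair joins `A₁` to `B₁` (parity), so
`⟨σ_{A₁∪B₁}⟩ ≤ (|A₁|+|B₁|)! · ∑_{a ∈ A₁, b ∈ B₁} ⟨σ_aσ_b⟩`; and the two-point function decays
exponentially below `β_c` (Aizenman–Barsky–Fernández 1987 ∕ Duminil-Copin–Tassion 2016, the tree's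
PROVED `twoPoint_exponentialDecay_of_lt_criticalBeta_holds`).

Main results (free infinite-volume state `freeCorr d β 0`, the box limit):

* `pairingSum_le_factorial_mul` — the Gaussian pairing functional `𝒢_n[S₂](x)` is at most
  `(2n)! · M` when `0 ≤ S₂ ≤ 1` and `S₂ ≤ M` across an odd set of indices;
* `isingCorr_free_oddUnion_le_factorial_mul` (finite volume, free b.c., zero field) and
  `freeCorr_oddUnion_le_factorial_mul_sum` (infinite volume):
  `⟨σ_{A₁∪B₁}⟩ ≤ (|A₁|+|B₁|)! ∑_{a∈A₁,b∈B₁} ⟨σ_aσ_b⟩` for disjoint odd `A₁`, `B₁`;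
* `freeCorr_evenCov_le_exp` — if `⟨σ_0σ_v⟩^∅_β ≤ e^{-κ‖v‖}` for all `v` then for even, disjoint
  `A`, `B` at sup-distance `≥ D`,
  `⟨σ_{A∆B}⟩^∅ - ⟨σ_A⟩^∅⟨σ_B⟩^∅ ≤ 2^{|A|+|B|} ((|A|+|B|)! |A||B| e^{-κD})²`;
* `freeCorr_evenCov_expDecay_of_lt_criticalBeta` — for `d ≥ 2`, `0 ≤ β < β_c(d)` there is `κ > 0`
  with `0 ≤ ⟨σ_{A∆B}⟩^∅ - ⟨σ_A⟩^∅⟨σ_B⟩^∅ ≤ C(|A|,|B|) e^{-2κD}` for all such `A`, `B`, `D`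
  (Glimm–Jaffe Cor. 17.2.2 on the lattice: mass `2κ` on the even sector).

Used by `MathematicalPhysics/QuantumFieldTheory/IsingGaugeWilsonLoopCovarianceDeconfined` (clustering
of Wilson loops of `ℤ₂` lattice gauge theory on `ℤ³` in the deconfined phase, by duality).

## References

* [GlimmJaffe1987] J. Glimm, A. Jaffe, *Quantum Physics. A Functional Integral Point of View*,
  2nd ed., Springer 1987: §4.3 Cor. 4.3.3 (PDF p. 61); §17.2 Thm. 17.2.1, Cor. 17.2.2 (PDF pp. 269–270).
* [AizenmanDuminilCopinAnnals2021] M. Aizenman, H. Duminil-Copin, Ann. of Math. 194 (2021), §6.3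
  (the Gaussian ∕ Newman inequality, first display, lower half).
* [AizenmanBarskyFernandezJSP1987] M. Aizenman, D. Barsky, R. Fernández, J. Stat. Phys. 47 (1987), Thm. 1.
* [Lebowitz1974] J. L. Lebowitz, Comm. Math. Phys. 35 (1974) 87–92.
-/

noncomputable section

open Finset Filter Topology MeasureTheory
open scoped symmDiff

namespace Literature.Probability.LatticeModels

/-! ### §1 Parity: an odd set of indices is split by some pair of every pairing -/

/-- In the perfect matching `{τ(2j), τ(2j+1)}_j` of `Fin (2n)` read off an ordering `τ`, a set `J`
of odd size is not a union of pairs: some pair has exactly one end in `J`. [folklore] -/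
private theorem exists_pair_separating {n : ℕ} (τ : Equiv.Perm (Fin (2 * n)))
    (J : Finset (Fin (2 * n))) (hJ : Odd J.card) :
    ∃ j : Fin n, (τ (pairIdx n (j, 0)) ∈ J ∧ τ (pairIdx n (j, 1)) ∉ J) ∨
      (τ (pairIdx n (j, 0)) ∉ J ∧ τ (pairIdx n (j, 1)) ∈ J) := by
  classical
  by_contra hcon
  push Not at hcon
  have hcount : J.card = ∑ j : Fin n, ((if τ (pairIdx n (j, 0)) ∈ J then 1 else 0) +
      (if τ (pairIdx n (j, 1)) ∈ J then 1 else 0)) := by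
    have h1 : ∑ i : Fin (2 * n), (if i ∈ J then (1 : ℕ) else 0) = J.card := by
      rw [Finset.sum_ite_mem, Finset.univ_inter, Finset.sum_const, smul_eq_mul, mul_one]
    rw [← h1, ← Equiv.sum_comp τ, ← Equiv.sum_comp (pairIdx n), Fintype.sum_prod_type]
    simp only [Fin.sum_univ_two]
  have heven : Even J.card := by
    rw [hcount]
    refine Finset.even_sum _ fun j _ => ?_
    obtain ⟨h1, h2⟩ := hcon j
    by_cases ha : τ (pairIdx n (j, 0)) ∈ J
    · rw [if_pos ha, if_pos (h1 ha)]; exact ⟨1, rfl⟩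
    · rw [if_neg ha, if_neg (h2 ha)]; exact ⟨0, rfl⟩
  exact (Nat.not_even_iff_odd.2 hJ) heven

/-! ### §2 The Gaussian pairing functional across an odd split -/

/-- **The pairing functional across an odd split.** If `0 ≤ S₂(xᵢ,xⱼ) ≤ 1` for all `i, j` and
`S₂ ≤ M` (in both orders) on every pair of points separated by an odd set `J` of indices, then
`𝒢_n[S₂](x₁,…,x_{2n}) ≤ (2n)! · M`: every pairing contains a pair separated by `J`
(`exists_pair_separating`), whose factor is `≤ M`, the other factors being `≤ 1`; there are
`(2n)!` orderings and the normalisation `(2ⁿ n!)⁻¹ ≤ 1`. (The combinatorial step of Glimm–Jaffe's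
Cor. 17.2.2 — odd observables couple to the one-particle states — in the Gaussian-inequality form.)
[cite: GlimmJaffe1987, §17.2 Cor. 17.2.2 (PDF p. 270); AizenmanDuminilCopinAnnals2021 §6.3 (𝒢_n)] -/
theorem pairingSum_le_factorial_mul {α : Type*} (S₂ : α → α → ℝ) (n : ℕ) (x : Fin (2 * n) → α)
    (h0 : ∀ i j, 0 ≤ S₂ (x i) (x j)) (h1 : ∀ i j, S₂ (x i) (x j) ≤ 1)
    (J : Finset (Fin (2 * n))) (hJ : Odd J.card) {M : ℝ} (hM0 : 0 ≤ M)
    (hM : ∀ i ∈ J, ∀ j ∉ J, S₂ (x i) (x j) ≤ M ∧ S₂ (x j) (x i) ≤ M) :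
    pairingSum S₂ n x ≤ ((2 * n).factorial : ℝ) * M := by
  classical
  have hterm : ∀ τ : Equiv.Perm (Fin (2 * n)),
      ∏ j : Fin n, S₂ (x (τ (pairIdx n (j, 0)))) (x (τ (pairIdx n (j, 1)))) ≤ M := by
    intro τ
    obtain ⟨j₀, hj₀⟩ := exists_pair_separating τ J hJ
    rw [← Finset.mul_prod_erase (univ : Finset (Fin n)) _ (Finset.mem_univ j₀)]
    have hle : S₂ (x (τ (pairIdx n (j₀, 0)))) (x (τ (pairIdx n (j₀, 1)))) ≤ M := by
      rcases hj₀ with ⟨ha, hb⟩ | ⟨ha, hb⟩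
      · exact (hM _ ha _ hb).1
      · exact (hM _ hb _ ha).2
    have hrest : ∏ j ∈ univ.erase j₀, S₂ (x (τ (pairIdx n (j, 0)))) (x (τ (pairIdx n (j, 1)))) ≤ 1 :=
      Finset.prod_le_one (fun j _ => h0 _ _) fun j _ => h1 _ _
    have hrest0 : 0 ≤ ∏ j ∈ univ.erase j₀, S₂ (x (τ (pairIdx n (j, 0)))) (x (τ (pairIdx n (j, 1)))) :=
      Finset.prod_nonneg fun j _ => h0 _ _
    calc _ ≤ M * 1 := mul_le_mul hle hrest hrest0 hM0
      _ = M := mul_one M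
  have hsum : ∑ τ : Equiv.Perm (Fin (2 * n)),
      ∏ j : Fin n, S₂ (x (τ (pairIdx n (j, 0)))) (x (τ (pairIdx n (j, 1)))) ≤
        ((2 * n).factorial : ℝ) * M := by
    refine (Finset.sum_le_sum fun τ _ => hterm τ).trans ?_
    rw [Finset.sum_const, nsmul_eq_mul, Finset.card_univ, Fintype.card_perm, Fintype.card_fin]
  have hsum0 : 0 ≤ ∑ τ : Equiv.Perm (Fin (2 * n)),
      ∏ j : Fin n, S₂ (x (τ (pairIdx n (j, 0)))) (x (τ (pairIdx n (j, 1)))) :=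
    Finset.sum_nonneg fun τ _ => Finset.prod_nonneg fun j _ => h0 _ _
  have hc : ((2 : ℝ) ^ n * n.factorial)⁻¹ ≤ 1 := by
    refine inv_le_one_of_one_le₀ ?_
    have h2 : (1 : ℝ) ≤ 2 ^ n := one_le_pow₀ (by norm_num)
    have h3 : (1 : ℝ) ≤ n.factorial := by exact_mod_cast Nat.factorial_pos n
    nlinarith
  unfold pairingSum
  calc ((2 : ℝ) ^ n * n.factorial)⁻¹ * _ ≤ 1 * _ := mul_le_mul_of_nonneg_right hc hsum0
    _ ≤ _ := by rw [one_mul]; exact hsum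

/-! ### §3 Finite volume: odd–odd correlations are controlled by two-point functions -/

variable {d : ℕ}

/-- `{a} ∆ {b} ⊆ Λ` for `a, b ∈ Λ`. [folklore] -/
private theorem symmDiff_singleton_subset {Λ : Finset (Site d)} {a b : Site d} (ha : a ∈ Λ)
    (hb : b ∈ Λ) : ({a} : Finset (Site d)) ∆ {b} ⊆ Λ := by
  intro z hz
  rw [Finset.mem_symmDiff, Finset.mem_singleton, Finset.mem_singleton] at hz
  rcases hz with ⟨rfl, -⟩ | ⟨rfl, -⟩
  · exact ha
  · exact hb

/-- `0 ≤ ⟨σ_X⟩^∅_{Λ;β,0} ≤ 1` for `X ⊆ Λ`, `β ≥ 0` (Griffiths I and `|σ_X| ≤ 1`). [folklore] -/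
private theorem isingCorr_free_mem_Icc {Λ X : Finset (Site d)} {β : ℝ} (hβ : 0 ≤ β) (hX : X ⊆ Λ) :
    0 ≤ isingCorr (zdGraph d) Λ β 0 .free X ∧ isingCorr (zdGraph d) Λ β 0 .free X ≤ 1 :=
  ⟨GKSInequalities.gks_one_holds (zdGraph d) hβ le_rfl (Or.inl rfl) hX,
    (abs_le.1 (abs_isingCorr_le_one (zdGraph d) Λ β 0 .free X)).2⟩

/-- **Odd–odd correlations are controlled by two-point functions, finite volume.** Nearest-neighbour
Ising model in a finite volume `Λ ⊂ ℤ^d`, free boundary condition, zero field, `β ≥ 0`; `A₁, B₁ ⊆ Λ`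
disjoint with `|A₁|`, `|B₁|` odd; if `⟨σ_aσ_b⟩_Λ ≤ M` (`M ≥ 0`) for all `a ∈ A₁`, `b ∈ B₁` then
`⟨σ_{A₁ ∪ B₁}⟩_Λ ≤ (|A₁|+|B₁|)! · M`. Proof: Newman's Gaussian inequality
`⟨σ_{x₁}⋯σ_{x_{2n}}⟩ ≤ 𝒢_n[⟨σσ⟩](x)` (`aizenman_nPoint_le_pairingSum_finite_holds`) for an
enumeration `x` of `A₁ ∪ B₁`, and `pairingSum_le_factorial_mul` with `J = x⁻¹(A₁)`; the case
`|A₁| = |B₁| = 1` is the hypothesis. (The lattice replacement for the spectral step of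
Glimm–Jaffe's Cor. 17.2.2: odd observables are orthogonal to the vacuum.)
[cite: GlimmJaffe1987, §17.2 Cor. 17.2.2 (PDF p. 270); AizenmanDuminilCopinAnnals2021 §6.3, first display, lower inequality] -/
theorem isingCorr_free_oddUnion_le_factorial_mul {Λ : Finset (Site d)} {β : ℝ} (hβ : 0 ≤ β)
    {A₁ B₁ : Finset (Site d)} (hA₁ : A₁ ⊆ Λ) (hB₁ : B₁ ⊆ Λ) (hdisj : Disjoint A₁ B₁)
    (hA : Odd A₁.card) (hB : Odd B₁.card) {M : ℝ} (hM0 : 0 ≤ M)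
    (hM : ∀ a ∈ A₁, ∀ b ∈ B₁, isingCorr (zdGraph d) Λ β 0 .free ({a} ∆ {b}) ≤ M) :
    isingCorr (zdGraph d) Λ β 0 .free (A₁ ∪ B₁) ≤ ((A₁ ∪ B₁).card.factorial : ℝ) * M := by
  classical
  set E := A₁ ∪ B₁ with hE
  have hcardE : E.card = A₁.card + B₁.card := by rw [hE, Finset.card_union_of_disjoint hdisj]
  obtain ⟨n, hn⟩ : ∃ n, E.card = 2 * n := by
    have hev : Even E.card := by rw [hcardE]; exact hA.add_odd hB
    obtain ⟨r, hr⟩ := hev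
    exact ⟨r, by rw [hr, two_mul]⟩
  rw [hn]
  rcases Nat.lt_or_ge n 2 with hn2 | hn2
  · -- `n = 1`: `A₁ = {a}`, `B₁ = {b}`, and the claim is the hypothesis
    have hApos : 0 < A₁.card := hA.pos
    have hBpos : 0 < B₁.card := hB.pos
    interval_cases n
    · omega
    · have hA1 : A₁.card = 1 := by omega
      have hB1 : B₁.card = 1 := by omega
      obtain ⟨a, rfl⟩ := Finset.card_eq_one.1 hA1
      obtain ⟨b, rfl⟩ := Finset.card_eq_one.1 hB1
      have hEeq : (({a} : Finset (Site d)) ∪ {b}) = {a} ∆ {b} := (hdisj.symmDiff_eq_sup).symm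
      rw [hE, hEeq]
      have h := hM a (Finset.mem_singleton_self a) b (Finset.mem_singleton_self b)
      have h2 : ((2 * 1).factorial : ℝ) = 2 := by norm_num [Nat.factorial]
      rw [h2]
      linarith
  · -- enumerate `E` by `Fin (2n)`
    set e : Fin (2 * n) ≃ ↥E := (finCongr hn.symm).trans E.equivFin.symm with he
    set x : Fin (2 * n) → Site d := fun i => (e i : Site d) with hx
    have hxinj : Function.Injective x := fun i j h => e.injective (Subtype.ext h)
    have hxE : ∀ i, x i ∈ E := fun i => (e i).2
    have hEΛ : E ⊆ Λ := Finset.union_subset hA₁ hB₁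
    have hxΛ : ∀ i, x i ∈ Λ := fun i => hEΛ (hxE i)
    have himage : univ.image x = E := by
      ext v
      simp only [Finset.mem_image, Finset.mem_univ, true_and]
      constructor
      · rintro ⟨i, rfl⟩; exact hxE i
      · intro hv; exact ⟨e.symm ⟨v, hv⟩, by simp [hx]⟩
    set μ := isingMeasure (zdGraph d) Λ β 0 .free with hμ
    -- the `2n`-point function of the enumeration is `⟨σ_E⟩`, its two-point function `⟨σ_{{a}∆{b}}⟩`
    have hN : nPoint μ spinAt x = isingCorr (zdGraph d) Λ β 0 .free E := by
      rw [← himage]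
      unfold nPoint isingCorr isingExpect spinProduct
      refine integral_congr_ae (Eventually.of_forall fun σ => ?_)
      have hpi : ∏ v ∈ univ.image x, spinAt v σ = ∏ i, spinAt (x i) σ :=
        Finset.prod_image fun i _ j _ h => hxinj h
      exact hpi.symm
    have h2 : ∀ i j, twoPoint μ spinAt (x i) (x j) =
        isingCorr (zdGraph d) Λ β 0 .free ({x i} ∆ {x j}) := by
      intro i j
      rw [← isingTwoPoint_eq_isingCorr_symmDiff]
      rfl
    -- the odd set of indices of `A₁`
    set J : Finset (Fin (2 * n)) := univ.filter fun i => x i ∈ A₁ with hJ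
    have hJcard : J.card = A₁.card := by
      rw [← Finset.card_image_of_injective J hxinj]
      congr 1
      ext v
      simp only [Finset.mem_image, hJ, Finset.mem_filter, Finset.mem_univ, true_and]
      constructor
      · rintro ⟨i, hi, rfl⟩; exact hi
      · intro hv
        exact ⟨e.symm ⟨v, Finset.mem_union_left _ hv⟩, by simp [hx, hv], by simp [hx]⟩
    have hJodd : Odd J.card := by rw [hJcard]; exact hA
    have hcross : ∀ i ∈ J, ∀ j ∉ J,
        twoPoint μ spinAt (x i) (x j) ≤ M ∧ twoPoint μ spinAt (x j) (x i) ≤ M := by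
      intro i hi j hj
      have hiA : x i ∈ A₁ := (Finset.mem_filter.1 hi).2
      have hjB : x j ∈ B₁ := by
        have hjA : x j ∉ A₁ := fun h => hj (Finset.mem_filter.2 ⟨Finset.mem_univ _, h⟩)
        rcases Finset.mem_union.1 (hxE j) with h | h
        · exact absurd h hjA
        · exact h
      refine ⟨?_, ?_⟩
      · rw [h2]; exact hM _ hiA _ hjB
      · rw [h2, symmDiff_comm]; exact hM _ hiA _ hjB
    have h0 : ∀ i j, 0 ≤ twoPoint μ spinAt (x i) (x j) := fun i j => by
      rw [h2]; exact (isingCorr_free_mem_Icc hβ (symmDiff_singleton_subset (hxΛ i) (hxΛ j))).1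
    have h1 : ∀ i j, twoPoint μ spinAt (x i) (x j) ≤ 1 := fun i j => by
      rw [h2]; exact (isingCorr_free_mem_Icc hβ (symmDiff_singleton_subset (hxΛ i) (hxΛ j))).2
    have hG := aizenman_nPoint_le_pairingSum_finite_holds Λ β hβ n hn2 x hxΛ
    rw [← hN]
    exact hG.trans (pairingSum_le_factorial_mul _ n x h0 h1 J hJodd hM0 hcross)

/-! ### §4 Infinite volume (free state of `ℤ^d`) -/

/-- **Odd–odd correlations are controlled by two-point functions, free infinite-volume state**:
for `β ≥ 0` and disjoint `A₁`, `B₁` of odd size,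
`⟨σ_{A₁∪B₁}⟩^∅_β ≤ (|A₁|+|B₁|)! ∑_{a ∈ A₁} ∑_{b ∈ B₁} ⟨σ_aσ_b⟩^∅_β` (box limits of the
finite-volume bound with `M = ∑∑ ⟨σ_aσ_b⟩_Λ`, each term being `≥ 0`).
[cite: GlimmJaffe1987, §17.2 Cor. 17.2.2 (PDF p. 270); AizenmanDuminilCopinAnnals2021 §6.3, first display, lower inequality] -/
theorem freeCorr_oddUnion_le_factorial_mul_sum {β : ℝ} (hβ : 0 ≤ β) {A₁ B₁ : Finset (Site d)}
    (hdisj : Disjoint A₁ B₁) (hA : Odd A₁.card) (hB : Odd B₁.card) :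
    freeCorr d β 0 (A₁ ∪ B₁) ≤
      ((A₁ ∪ B₁).card.factorial : ℝ) * ∑ a ∈ A₁, ∑ b ∈ B₁, freeCorr d β 0 ({a} ∆ {b}) := by
  classical
  have hlim : ∀ X : Finset (Site d),
      Tendsto (fun L : ℕ => isingCorr (zdGraph d) (box d L) β 0 .free X) atTop
        (𝓝 (freeCorr d β 0 X)) :=
    fun X => hasBoxLimit_isingCorr_free_holds hβ le_rfl X
  obtain ⟨L₀, hL₀⟩ := exists_forall_subset_box d (A₁ ∪ B₁)
  have hev : ∀ᶠ L : ℕ in atTop, isingCorr (zdGraph d) (box d L) β 0 .free (A₁ ∪ B₁) ≤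
      ((A₁ ∪ B₁).card.factorial : ℝ) *
        ∑ a ∈ A₁, ∑ b ∈ B₁, isingCorr (zdGraph d) (box d L) β 0 .free ({a} ∆ {b}) := by
    filter_upwards [eventually_ge_atTop L₀] with L hL
    have hsub := hL₀ L hL
    have hA₁ : A₁ ⊆ box d L := Finset.subset_union_left.trans hsub
    have hB₁ : B₁ ⊆ box d L := Finset.subset_union_right.trans hsub
    have hnn : ∀ a ∈ A₁, ∀ b ∈ B₁,
        0 ≤ isingCorr (zdGraph d) (box d L) β 0 .free ({a} ∆ {b}) :=
      fun a ha b hb => (isingCorr_free_mem_Icc hβ (symmDiff_singleton_subset (hA₁ ha) (hB₁ hb))).1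
    refine isingCorr_free_oddUnion_le_factorial_mul hβ hA₁ hB₁ hdisj hA hB
      (Finset.sum_nonneg fun a ha => Finset.sum_nonneg fun b hb => hnn a ha b hb) fun a ha b hb => ?_
    calc isingCorr (zdGraph d) (box d L) β 0 .free ({a} ∆ {b})
        ≤ ∑ b' ∈ B₁, isingCorr (zdGraph d) (box d L) β 0 .free ({a} ∆ {b'}) :=
          Finset.single_le_sum (fun b' hb' => hnn a ha b' hb') hb
      _ ≤ ∑ a' ∈ A₁, ∑ b' ∈ B₁, isingCorr (zdGraph d) (box d L) β 0 .free ({a'} ∆ {b'}) :=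
          Finset.single_le_sum
            (f := fun a' => ∑ b' ∈ B₁, isingCorr (zdGraph d) (box d L) β 0 .free ({a'} ∆ {b'}))
            (fun a' ha' => Finset.sum_nonneg fun b' hb' => hnn a' ha' b' hb') ha
  exact le_of_tendsto_of_tendsto (hlim _)
    ((tendsto_finsetSum _ fun a _ => tendsto_finsetSum _ fun b _ => hlim _).const_mul _) hev

/-! ### §5 Exponential clustering of even observables from two-point decay -/

/-- A two-point decay hypothesis `⟨σ_0σ_v⟩^∅_β ≤ e^{-κ‖v‖}` bounds `⟨σ_{{a}∆{b}}⟩^∅_β ≤ e^{-κD}`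
whenever `a ≠ b` and `D ≤ ‖a - b‖` (translation invariance of the free state).
[cite: AizenmanBarskyFernandezJSP1987, Thm. 1] -/
theorem freeCorr_singleton_symmDiff_le_exp {β κ : ℝ} (hβ : 0 ≤ β) (hκ : 0 ≤ κ)
    (hdec : ∀ v : Site d, twoPointFree d β v ≤ Real.exp (-κ * ‖v‖)) {a b : Site d} (hab : a ≠ b)
    {D : ℝ} (hD : D ≤ ‖a - b‖) :
    freeCorr d β 0 ({a} ∆ {b}) ≤ Real.exp (-(κ * D)) := by
  have hv0 : b - a ≠ 0 := sub_ne_zero.2 hab.symm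
  have hpair : (({a} : Finset (Site d)) ∆ {b}) = {a, a + (b - a)} := by
    rw [add_sub_cancel]
    ext z
    simp only [Finset.mem_symmDiff, Finset.mem_singleton, Finset.mem_insert]
    constructor
    · rintro (⟨h1, -⟩ | ⟨h1, -⟩)
      · exact Or.inl h1
      · exact Or.inr h1
    · rintro (rfl | rfl)
      · exact Or.inl ⟨rfl, hab⟩
      · exact Or.inr ⟨rfl, hab.symm⟩
  rw [hpair, freeCorr_pair_shift hβ a (b - a), ← twoPointFree_eq_freeCorr _ hv0]
  refine (hdec _).trans (Real.exp_le_exp.2 ?_)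
  rw [← norm_neg, neg_sub] at hD
  nlinarith

/-- **Odd–odd correlations between separated sets decay like the two-point function**: under the
decay hypothesis, for disjoint `A₁`, `B₁` of odd size at sup-distance `≥ D`,
`⟨σ_{A₁∪B₁}⟩^∅_β ≤ (|A₁|+|B₁|)! |A₁||B₁| e^{-κD}`.
[cite: GlimmJaffe1987, §17.2 Cor. 17.2.2 (PDF p. 270)] -/
theorem freeCorr_oddUnion_le_exp {β κ : ℝ} (hβ : 0 ≤ β) (hκ : 0 ≤ κ)
    (hdec : ∀ v : Site d, twoPointFree d β v ≤ Real.exp (-κ * ‖v‖)) {A₁ B₁ : Finset (Site d)}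
    (hdisj : Disjoint A₁ B₁) (hA : Odd A₁.card) (hB : Odd B₁.card) {D : ℝ}
    (hD : ∀ a ∈ A₁, ∀ b ∈ B₁, D ≤ ‖a - b‖) :
    freeCorr d β 0 (A₁ ∪ B₁) ≤
      ((A₁.card + B₁.card).factorial : ℝ) * (A₁.card * B₁.card) * Real.exp (-(κ * D)) := by
  have h := freeCorr_oddUnion_le_factorial_mul_sum hβ hdisj hA hB
  rw [Finset.card_union_of_disjoint hdisj] at h
  refine h.trans ?_
  have hsum : ∑ a ∈ A₁, ∑ b ∈ B₁, freeCorr d β 0 ({a} ∆ {b}) ≤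
      ∑ a ∈ A₁, ∑ b ∈ B₁, Real.exp (-(κ * D)) :=
    Finset.sum_le_sum fun a ha => Finset.sum_le_sum fun b hb =>
      freeCorr_singleton_symmDiff_le_exp hβ hκ hdec
        (fun h => (Finset.disjoint_left.1 hdisj ha) (by rw [h]; exact hb)) (hD a ha b hb)
  rw [mul_assoc]
  refine mul_le_mul_of_nonneg_left ?_ (Nat.cast_nonneg _)
  calc _ ≤ ∑ a ∈ A₁, ∑ b ∈ B₁, Real.exp (-(κ * D)) := hsum
    _ = _ := by simp only [Finset.sum_const, nsmul_eq_mul]; ring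

/-- **Glimm–Jaffe Cor. 17.2.2 on the lattice, quantitative form.** For the free zero-field Ising state
on `ℤ^d` at `β ≥ 0` with `⟨σ_0σ_v⟩^∅_β ≤ e^{-κ‖v‖}` for all `v` (`κ ≥ 0`), and finite DISJOINT sets
`A`, `B` of EVEN size at sup-distance `≥ D` (`D ≤ ‖a - b‖` for `a ∈ A`, `b ∈ B`):
`⟨σ_{A∆B}⟩^∅ - ⟨σ_A⟩^∅⟨σ_B⟩^∅ ≤ 2^{|A|+|B|} ((|A|+|B|)! · |A||B| · e^{-κD})²` — twice the two-point
rate. Proof: the pair-truncation tree bound (Cor. 4.3.3 = Thm. 17.2.1, the tree's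
`freeCorr_two_mul_cov_le_sum_odd`) has at most `2^{|A|+|B|}` summands, each a product of two odd–odd
correlations across the gap (`A ∖ A₁`, `B ∖ B₁` are odd because `A`, `B` are even), each bounded by
`freeCorr_oddUnion_le_exp`. [cite: GlimmJaffe1987, §17.2 Thm. 17.2.1 and Cor. 17.2.2 (PDF pp. 269–270); §4.3 Cor. 4.3.3 (PDF p. 61)] -/
theorem freeCorr_evenCov_le_exp {β κ : ℝ} (hβ : 0 ≤ β) (hκ : 0 ≤ κ)
    (hdec : ∀ v : Site d, twoPointFree d β v ≤ Real.exp (-κ * ‖v‖)) {A B : Finset (Site d)}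
    (hA : Even A.card) (hB : Even B.card) (hAB : Disjoint A B) {D : ℝ}
    (hD : ∀ a ∈ A, ∀ b ∈ B, D ≤ ‖a - b‖) :
    freeCorr d β 0 (A ∆ B) - freeCorr d β 0 A * freeCorr d β 0 B ≤
      2 ^ (A.card + B.card) *
        (((A.card + B.card).factorial : ℝ) * (A.card * B.card) * Real.exp (-(κ * D))) ^ 2 := by
  classical
  have hGJ := freeCorr_two_mul_cov_le_sum_odd (d := d) hβ hA hB
  set X : ℝ := ((A.card + B.card).factorial : ℝ) * (A.card * B.card) * Real.exp (-(κ * D)) with hX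
  have hX0 : 0 ≤ X := by positivity
  -- the generic odd–odd factor across the gap
  have hfac : ∀ {A₁ B₁ : Finset (Site d)}, A₁ ⊆ A → B₁ ⊆ B → Odd A₁.card → Odd B₁.card →
      freeCorr d β 0 (A₁ ∆ B₁) ≤ X := by
    intro A₁ B₁ hA₁ hB₁ hoA hoB
    have hd : Disjoint A₁ B₁ := hAB.mono hA₁ hB₁
    rw [hd.symmDiff_eq_sup, Finset.sup_eq_union]
    refine (freeCorr_oddUnion_le_exp hβ hκ hdec hd hoA hoB
      fun a ha b hb => hD a (hA₁ ha) b (hB₁ hb)).trans ?_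
    have hc1 : A₁.card ≤ A.card := Finset.card_le_card hA₁
    have hc2 : B₁.card ≤ B.card := Finset.card_le_card hB₁
    have hf : ((A₁.card + B₁.card).factorial : ℝ) ≤ ((A.card + B.card).factorial : ℝ) := by
      exact_mod_cast Nat.factorial_le (by omega)
    have hprod : ((A₁.card : ℝ) * B₁.card) ≤ (A.card : ℝ) * B.card := by
      exact_mod_cast Nat.mul_le_mul hc1 hc2
    have he : 0 ≤ Real.exp (-(κ * D)) := (Real.exp_pos _).le
    rw [hX]
    exact mul_le_mul_of_nonneg_right (mul_le_mul hf hprod (by positivity) (by positivity)) he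
  -- each term of the tree bound is at most `X²`
  have hterm : ∀ p ∈ (A.powerset ×ˢ B.powerset).filter (fun p => Odd p.1.card ∧ Odd p.2.card),
      freeCorr d β 0 (p.1 ∆ p.2) * freeCorr d β 0 ((A \ p.1) ∆ (B \ p.2)) ≤ X ^ 2 := by
    intro p hp
    simp only [Finset.mem_filter, Finset.mem_product, Finset.mem_powerset] at hp
    obtain ⟨⟨h1, h2⟩, ho1, ho2⟩ := hp
    have hoddA : Odd (A \ p.1).card := by
      rw [Finset.card_sdiff_of_subset h1]
      refine Nat.not_even_iff_odd.1 fun hev => ?_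
      exact (Nat.not_even_iff_odd.2 ho1) ((Nat.even_sub (Finset.card_le_card h1)).1 hev |>.1 hA)
    have hoddB : Odd (B \ p.2).card := by
      rw [Finset.card_sdiff_of_subset h2]
      refine Nat.not_even_iff_odd.1 fun hev => ?_
      exact (Nat.not_even_iff_odd.2 ho2) ((Nat.even_sub (Finset.card_le_card h2)).1 hev |>.1 hB)
    calc _ ≤ X * X := mul_le_mul (hfac h1 h2 ho1 ho2)
          (hfac Finset.sdiff_subset Finset.sdiff_subset hoddA hoddB) (freeCorr_nonneg hβ le_rfl _) hX0
      _ = X ^ 2 := (sq X).symm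
  have hsum := Finset.sum_le_sum hterm
  rw [Finset.sum_const, nsmul_eq_mul] at hsum
  have hcard : (((A.powerset ×ˢ B.powerset).filter
      (fun p => Odd p.1.card ∧ Odd p.2.card)).card : ℝ) ≤ 2 ^ (A.card + B.card) := by
    have h := Finset.card_filter_le (A.powerset ×ˢ B.powerset) (fun p => Odd p.1.card ∧ Odd p.2.card)
    rw [Finset.card_product, Finset.card_powerset, Finset.card_powerset, ← pow_add] at h
    exact_mod_cast h
  have hX2 : 0 ≤ X ^ 2 := sq_nonneg _
  have hk := mul_le_mul_of_nonneg_right hcard hX2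
  have h2pos : (0 : ℝ) ≤ 2 ^ (A.card + B.card) * X ^ 2 := by positivity
  linarith

/-- **Exponential clustering of even observables below `β_c` (Glimm–Jaffe 1987, §17.2 Thm. 17.2.1 ∕
Cor. 17.2.2, «no even bound states below the two-particle threshold», for the nearest-neighbour Ising
model on `ℤ^d`).** For `d ≥ 2` and `0 ≤ β < β_c(d)` there is `κ > 0` (the sharpness rate of the
two-point function, Aizenman–Barsky–Fernández ∕ Duminil-Copin–Tassion, the tree's
`twoPoint_exponentialDecay_of_lt_criticalBeta_holds`) such that for all finite disjoint `A`, `B` of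
even size and every `D` with `D ≤ ‖a - b‖` (`a ∈ A`, `b ∈ B`):
`0 ≤ ⟨σ_{A∆B}⟩^∅_β - ⟨σ_A⟩^∅_β⟨σ_B⟩^∅_β ≤ 2^{|A|+|B|} ((|A|+|B|)! |A||B|)² e^{-2κD}` — the truncated
correlations of even observables decay at (at least) TWICE the two-point rate. The lower bound is
Griffiths' second inequality. [cite: GlimmJaffe1987, §17.2 Thm. 17.2.1 and Cor. 17.2.2 (PDF pp. 269–270); AizenmanBarskyFernandezJSP1987 Thm. 1] -/
theorem freeCorr_evenCov_expDecay_of_lt_criticalBeta (hd : 2 ≤ d) {β : ℝ} (hβ : 0 ≤ β)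
    (hβc : β < criticalBeta d) :
    ∃ κ : ℝ, 0 < κ ∧ ∀ (A B : Finset (Site d)), Even A.card → Even B.card → Disjoint A B →
      ∀ D : ℝ, (∀ a ∈ A, ∀ b ∈ B, D ≤ ‖a - b‖) →
        0 ≤ freeCorr d β 0 (A ∆ B) - freeCorr d β 0 A * freeCorr d β 0 B ∧
        freeCorr d β 0 (A ∆ B) - freeCorr d β 0 A * freeCorr d β 0 B ≤
          2 ^ (A.card + B.card) * (((A.card + B.card).factorial : ℝ) * (A.card * B.card)) ^ 2 *
            Real.exp (-(2 * κ * D)) := by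
  obtain ⟨κ, hκ, hdec⟩ := twoPoint_exponentialDecay_of_lt_criticalBeta_holds (d := d) hd hβ hβc
  refine ⟨κ, hκ, fun A B hA hB hAB D hD => ⟨?_, ?_⟩⟩
  · exact sub_nonneg.2 (freeCorr_mul_le hβ le_rfl A B)
  · have h := freeCorr_evenCov_le_exp hβ hκ.le hdec hA hB hAB hD
    have hexp : Real.exp (-(κ * D)) ^ 2 = Real.exp (-(2 * κ * D)) := by
      rw [sq, ← Real.exp_add]; ring_nf
    calc _ ≤ _ := h
      _ = _ := by rw [mul_pow, hexp]; ring

end Literature.Probability.LatticeModels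

end
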